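import Summits.BirchSwinnertonDyer.BirchSwinnertonDyer.Statement
import Summits.BirchSwinnertonDyer.BirchSwinnertonDyer.Theorems.SoloBlindPAdicSqueeze
import Literature.NumberTheory.EllipticCurves.PAdicLFunctionOrderTransferRankOneProofs
import Literature.NumberTheory.EllipticCurves.BSDRankResidualCellsProofs
import Literature.NumberTheory.EllipticCurves.BSDSelmerCMPConverseRankOneProofs
import HarnessLib.Audit.Tags

/-!
# Solo (blind) — what the `p`-adic rank conjecture buys: everything up to degree three, nothing beyond

Fourth kernel-checked reduction of the soloist programme `solo-BirchSwinnertonDyer-blind`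
(companions: `SoloBlindCellDecomposition`, `SoloBlindShaCells`, `SoloBlindPAdicSqueeze`).
Write `a = analyticRank` (`ord_{s=1} L(E,s)`), `r = mordellWeilRank` (`rank E(ℚ)`) and, at a prime
`p ≥ 5` of good ordinary reduction with `E[p]` irreducible (a *suitable* prime; every `E/ℚ` has
infinitely many, tree theorem `exists_gt_mem_goodOrdinaryPrimes_hasIrreducibleModPGaloisRep`) and a
newform `f` of `E`, `ρ_p = ord_{T=0} L_p(f, α_p, T)` (`PowerSeries.order` of
`padicLFunction f (unitRoot W p)`).  The summit `BirchSwinnertonDyer` is `∀ E/ℚ, a = r`.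

`PAdicBSDRank` is the rank clause of the Mazur–Tate–Teitelbaum `p`-adic Birch–Swinnerton-Dyer
conjecture in the non-exceptional case, asked at suitable primes only: `ρ_p = r`.  It is often
described as "more accessible" than the classical rank conjecture (one inequality, `r ≤ ρ_p`, is
Kato's theorem).  This file measures exactly what it would buy.

1. `padicBSDRank_iff_shaFiniteSchneider` — over modularity, Mazur's main conjecture
   (Burungale–Castella–Skinner) and Perrin-Riou–Schneider, `PAdicBSDRank` is EQUIVALENT to the
   purely algebraic / `p`-adic-analytic statement `ShaFiniteSchneider`: at every suitable prime,
   `Ш(E)[p^∞]` is finite and the canonical cyclotomic `p`-adic height is non-degenerate.  No complex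
   `L`-function occurs on either side.
2. `bsd_iff_orderAgreementFromFour_of_padicBSDRank` — GRANTING `PAdicBSDRank` (and the published
   facts: Gross–Zagier–Kolyvagin, the rank-one `p`-converses of Kim and Burungale–Tian, `p`-parity,
   modularity, the main conjecture, Perrin-Riou–Schneider), the classical rank conjecture is
   equivalent to `OrderAgreementFromFour`: *the complex and the `p`-adic order of vanishing agree
   whenever either is at least four*.  Everything below degree four is absorbed by theorems in print
   (`two_le_min_of_analyticRank_ne_mordellWeilRank_of_padicBSDRank`: a failure `a ≠ r` would have
   `2 ≤ min(a,r)`, `a ≡ r (mod 2)`, `4 ≤ max(a,r)`; first cells `(a,r) = (2,4)` and `(4,2)`).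
3. `bsd_and_shaFiniteSchneider_iff_padicBSDRank_and_orderAgreementFromFour` — the exchange
   identity: `(classical rank BSD ∧ ShaFiniteSchneider) ↔ (p-adic rank BSD ∧ OrderAgreementFromFour)`.
4. `bsd_iff_fourLayers_of_padicBSDRank` — the same residual in `(a, r)`-terms: granting
   `PAdicBSDRank`, `BSD ↔ (∀ E, r ≥ 4 → r ≤ a) ∧ (∀ E, a ≥ 4 → a ≤ r)`.

Reading for the census: the `p`-adic rank conjecture converts the Selmer side completely
(`corank Sel_{p^∞} = r`, parity of `r`, the cells `max(a,r) ≤ 3` via the corank-`0`/`1`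
`p`-converses and Gross–Zagier–Kolyvagin) and contributes NOTHING to the comparison of `a` with
`r` from degree four on: what is left is a transfer statement between two `L`-functions of the same
newform, in both directions, of which no instance in degree `≥ 2` is a theorem
(cf. `Literature.NumberTheory.EllipticCurves.four_le_order_padicLFunction_or_residual`).

All facts enter as hypotheses BY NAME and are theorems in print:
`rank_eq_analyticRank_of_analyticRank_le_one` (Gross–Zagier 1986, Kolyvagin 1990; Darmon 2004,
Thm. 3.22), `kim_analyticRank_eq_one_of_mordellWeilRank_eq_one` (Kim, Math. Ann. 387 (2022),
Cor. 1.4), `burungaleTian_analyticRank_eq_one_of_selmerCorank_eq_one_of_hasCM` (Burungale–Tian,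
Invent. Math. 220 (2020), Thm. 1.2), `exists_isNewformOf` (Breuil–Conrad–Diamond–Taylor 2001),
`burungale_castella_skinner_charIdeal_eq_padicLFunction` (IMRN 2025, Thm. 1.1.2 (a)),
`Schneider1985_order_charGenerator` (Schneider 1985 / Perrin-Riou; Balakrishnan–Müller–Stein,
Math. Comp. 85 (2016), Thm. 1.7), `selmerCorank_mod_two_eq` (Dokchitser–Dokchitser, Ann. of
Math. 172 (2010), Thm. 1.4).
-/

set_option linter.dupNamespace false

open scoped Classical MatrixGroups ModularForm
open CongruenceSubgroup Literature.NumberTheory.EllipticCurves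
  Literature.NumberTheory.EllipticCurves.ModularForms WeierstrassCurve

namespace Summit.BirchSwinnertonDyer.BirchSwinnertonDyer.Theorems.SoloBlind

/-- **The `p`-adic rank conjecture at suitable primes** (Mazur–Tate–Teitelbaum 1986, the rank
clause of "BSD(p)" in the non-exceptional case; OPEN — `≥` is Kato's theorem, `=` is known only for
`r ≤ 1` under finiteness of `Ш` and non-degeneracy of the height): for every `E/ℚ` with globally
minimal equation `W`, every prime `p ≥ 5` of good ordinary reduction with `E[p]` irreducible and
every weight-two newform `f` of `E`, `ord_{T=0} L_p(f, α_p, T) = rank E(ℚ)`.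
[cite: MazurTateTeitelbaum1986Invent, §II.18–19 (conjecture BSD(p), rank clause)]
[cite: Kato2004, Thm 18.4 (the inequality `≥`)] -/
@[conjecture] def PAdicBSDRank : Prop :=
  ∀ (W : WeierstrassCurve ℚ) [W.IsElliptic] [W.IsGloballyMinimal] (p : ℕ) [Fact p.Prime],
    5 ≤ p → W.HasGoodReductionAtPrime p → ¬ (p : ℤ) ∣ W.frobeniusTrace p →
    W.HasIrreducibleModPGaloisRep p →
    ∀ {N : ℕ} [NeZero N] (f : CuspForm (Gamma0 N) 2), IsNewformOf W f →
      (padicLFunction f (unitRoot W p : ℚ_[p])).order = (W.mordellWeilRank : ℕ∞)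

/-- **Finiteness of `Ш[p^∞]` and Schneider's non-degeneracy at suitable primes** (OPEN; both are
standard conjectures — Tate–Shafarevich, and Schneider 1982 / Mazur–Stein–Tate 2006, Conj. 1.1): for
every `E/ℚ` with globally minimal equation `W` and every prime `p ≥ 5` of good ordinary reduction
with `E[p]` irreducible, `Ш(E)[p^∞]` is finite and the canonical cyclotomic `p`-adic height pairing
on `E(ℚ)` is non-degenerate. [cite: MazurSteinTate2006, Conj. 1.1]
[cite: Wiles2000, §1 (finiteness of the Tate–Shafarevich group)] -/
@[conjecture] def ShaFiniteSchneider : Prop :=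
  ∀ (W : WeierstrassCurve ℚ) [W.IsElliptic] [W.IsGloballyMinimal] (p : ℕ) [Fact p.Prime],
    5 ≤ p → W.HasGoodReductionAtPrime p → ¬ (p : ℤ) ∣ W.frobeniusTrace p →
    W.HasIrreducibleModPGaloisRep p →
    Finite (AddCommGroup.primaryComponent W.sha p) ∧
      ∀ Dh : PAdicHeightData W p, Dh.IsCanonical → SchneiderConjecture Dh

/-- **Agreement of the complex and `p`-adic orders of vanishing from degree four on** (OPEN; a
fragment of the Mazur–Tate–Teitelbaum comparison `ord_{T=0} L_p = ord_{s=1} L` in the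
non-exceptional case, of which no instance in degree `≥ 2` is a theorem): for every `E/ℚ` with
globally minimal equation `W`, every prime `p ≥ 5` of good ordinary reduction with `E[p]`
irreducible and every newform `f` of `E`: if `ord_{T=0} L_p(f, α_p, T) ≥ 4` or
`ord_{s=1} L(E,s) ≥ 4`, the two orders are equal.
[cite: MazurTateTeitelbaum1986Invent, §II.18–19 (conjecture BSD(p): `ord_T L_p = ord_s L`, non-exceptional case)] -/
@[conjecture] def OrderAgreementFromFour : Prop :=
  ∀ (W : WeierstrassCurve ℚ) [W.IsElliptic] [W.IsGloballyMinimal] (p : ℕ) [Fact p.Prime],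
    5 ≤ p → W.HasGoodReductionAtPrime p → ¬ (p : ℤ) ∣ W.frobeniusTrace p →
    W.HasIrreducibleModPGaloisRep p →
    ∀ {N : ℕ} [NeZero N] (f : CuspForm (Gamma0 N) 2), IsNewformOf W f →
      (4 ≤ (padicLFunction f (unitRoot W p : ℚ_[p])).order ∨ 4 ≤ W.analyticRank) →
      (padicLFunction f (unitRoot W p : ℚ_[p])).order = (W.analyticRank : ℕ∞)

section Facts

/-! ### 1. `p`-adic rank BSD is `Ш[p^∞]`-finiteness plus Schneider, and nothing analytic -/

/-- **`PAdicBSDRank ↔ ShaFiniteSchneider`** over modularity, Mazur's main conjecture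
(Burungale–Castella–Skinner: `ρ_p = ord_T f_E` for the characteristic series `f_E` of the dual
Selmer group over `ℚ_∞`) and Perrin-Riou–Schneider (`ord_T f_E = r ↔` height non-degenerate `∧`
`Ш[p^∞]` finite). [cite: BalakrishnanMullerStein2015, Thm. 1.7]
[cite: BurungaleCastellaSkinner2025, Thm. 1.1.2 (a)] [cite: MazurSteinTate2006, Conj. 1.1] -/
theorem padicBSDRank_iff_shaFiniteSchneider
    (hmod : exists_isNewformOf) (hMC : burungale_castella_skinner_charIdeal_eq_padicLFunction)
    (hS : Schneider1985_order_charGenerator) :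
    PAdicBSDRank ↔ ShaFiniteSchneider := by
  constructor
  · intro h W _ _ p _ hp hgood hord hirr
    obtain ⟨κ, hκ, γ, hγ, hγ'⟩ := exists_isCyclotomic_isTopGenerator_isCyclotomicVariable_holds p
    obtain ⟨D⟩ := W.nonempty_selmerDualData_holds κ γ hγ
    haveI : Module.Finite (IwasawaAlgebra p) D.X := D.module_finite_holds hγ
    haveI : NeZero (W.conductorNorm ℤ) := ⟨(W.conductorNorm_pos_holds).ne'⟩
    obtain ⟨f, hf⟩ := hmod W
    obtain ⟨g, hX, hchar, hρg⟩ :=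
      order_padicLFunction_eq_order_charGenerator W p hMC hp hgood hord hirr hκ hγ hγ' hf D
    obtain ⟨Dh₀, hDh₀, -⟩ := existsUnique_isCanonical_holds W p hp hgood hord
    have hgr : g.order = W.mordellWeilRank := by rw [← hρg]; exact h W p hp hgood hord hirr f hf
    exact ⟨((hS.order_eq_iff hp hgood hord hκ hγ hγ' D hX hchar hDh₀).1 hgr).2,
      fun Dh hDh => ((hS.order_eq_iff hp hgood hord hκ hγ hγ' D hX hchar hDh).1 hgr).1⟩
  · intro h W _ _ p _ hp hgood hord hirr N _ f hf
    obtain ⟨hfin, hSch⟩ := h W p hp hgood hord hirr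
    obtain ⟨κ, hκ, γ, hγ, hγ'⟩ := exists_isCyclotomic_isTopGenerator_isCyclotomicVariable_holds p
    obtain ⟨D⟩ := W.nonempty_selmerDualData_holds κ γ hγ
    haveI : Module.Finite (IwasawaAlgebra p) D.X := D.module_finite_holds hγ
    obtain ⟨g, hX, hchar, hρg⟩ :=
      order_padicLFunction_eq_order_charGenerator W p hMC hp hgood hord hirr hκ hγ hγ' hf D
    obtain ⟨Dh, hDh, -⟩ := existsUnique_isCanonical_holds W p hp hgood hord
    rw [hρg]
    exact (hS.order_eq_iff hp hgood hord hκ hγ hγ' D hX hchar hDh).2 ⟨hSch Dh hDh, hfin⟩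

/-- **Corollary: `PAdicBSDRank` gives finiteness of `Ш(E)[p^∞]` at every suitable prime.**
[cite: BalakrishnanMullerStein2015, Thm. 1.7] [cite: BurungaleCastellaSkinner2025, Thm. 1.1.2 (a)] -/
theorem finite_shaPrimary_of_padicBSDRank
    (hmod : exists_isNewformOf) (hMC : burungale_castella_skinner_charIdeal_eq_padicLFunction)
    (hS : Schneider1985_order_charGenerator) (hP : PAdicBSDRank)
    (W : WeierstrassCurve ℚ) [W.IsElliptic] [W.IsGloballyMinimal] (p : ℕ) [Fact p.Prime]
    (hp : 5 ≤ p) (hgood : W.HasGoodReductionAtPrime p) (hord : ¬ (p : ℤ) ∣ W.frobeniusTrace p)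
    (hirr : W.HasIrreducibleModPGaloisRep p) :
    Finite (AddCommGroup.primaryComponent W.sha p) :=
  ((padicBSDRank_iff_shaFiniteSchneider hmod hMC hS).1 hP W p hp hgood hord hirr).1

/-! ### 2. Granting `PAdicBSDRank`, the residual of the rank conjecture starts in degree four -/

/-- **The residual cells granting `PAdicBSDRank`, on a globally minimal model.** With the rank-one
`p`-converses (Kim; Burungale–Tian), `p`-parity, Gross–Zagier–Kolyvagin, modularity, the main
conjecture and Perrin-Riou–Schneider: if `ord_{s=1} L(E,s) ≠ rank E(ℚ)` then `2 ≤ ord`, `2 ≤ rank`,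
the two have the same parity and `4 ≤ max`.  (At a suitable prime `p`: `Ш[p^∞]` is finite, so
`corank Sel_{p^∞} = r` and the corank-one `p`-converse needed by
`two_le_min_of_analyticRank_ne_mordellWeilRank_of_finite_shaPrimary` is the rank-one one.)
[cite: Kim2022, Cor. 1.4] [cite: DokchitserDokchitserAnnals2010, Thm. 1.4] [cite: Darmon2004, Thm. 3.22] -/
theorem two_le_min_of_analyticRank_ne_mordellWeilRank_of_padicBSDRank_of_isGloballyMinimal
    (hGZK : rank_eq_analyticRank_of_analyticRank_le_one)
    (hKim : kim_analyticRank_eq_one_of_mordellWeilRank_eq_one)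
    (hBT : burungaleTian_analyticRank_eq_one_of_selmerCorank_eq_one_of_hasCM)
    (hmod : exists_isNewformOf) (hMC : burungale_castella_skinner_charIdeal_eq_padicLFunction)
    (hS : Schneider1985_order_charGenerator)
    (hpar : ∀ (W : WeierstrassCurve ℚ) [W.IsElliptic] (p : ℕ) [Fact p.Prime],
      selmerCorank_mod_two_eq W p)
    (hP : PAdicBSDRank)
    (W : WeierstrassCurve ℚ) [W.IsElliptic] [W.IsGloballyMinimal]
    (hne : W.analyticRank ≠ W.mordellWeilRank) :
    2 ≤ W.analyticRank ∧ 2 ≤ W.mordellWeilRank ∧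
      W.analyticRank % 2 = W.mordellWeilRank % 2 ∧ 4 ≤ max W.analyticRank W.mordellWeilRank := by
  obtain ⟨p, hgt, ⟨hp, hgood, hord⟩, hirr⟩ :=
    W.exists_gt_mem_goodOrdinaryPrimes_hasIrreducibleModPGaloisRep 4
  have hsha : Finite (AddCommGroup.primaryComponent W.sha p) :=
    finite_shaPrimary_of_padicBSDRank hmod hMC hS hP W p (by omega) hgood hord hirr
  have hconv1 : W.selmerCorank p = 1 → W.analyticRank = 1 := fun h1 => by
    have hs := selmerCorank_eq_mordellWeilRank_of_finite_shaPrimary W p hsha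
    exact analyticRank_eq_one_of_mordellWeilRank_eq_one_of_finite_sha_primary hKim hBT W p
      (by omega) hgood hord (fun _ => hirr) (by rw [← hs]; exact h1) hsha
  exact two_le_min_of_analyticRank_ne_mordellWeilRank_of_finite_shaPrimary W p hmod hMC hS hGZK
    (by omega) hgood hord hirr (hpar W p) hconv1 hsha hne

/-- **The residual cells granting `PAdicBSDRank`, for every elliptic curve over `ℚ`**: a failure
`ord_{s=1} L(E,s) ≠ rank E(ℚ)` has `2 ≤ ord`, `2 ≤ rank`, equal parities and `4 ≤ max(ord, rank)`;
the first cells not excluded are `(ord, rank) = (2,4)` and `(4,2)`.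
[cite: Kim2022, Cor. 1.4] [cite: DokchitserDokchitserAnnals2010, Thm. 1.4] [cite: Darmon2004, Thm. 3.22] -/
theorem two_le_min_of_analyticRank_ne_mordellWeilRank_of_padicBSDRank
    (hGZK : rank_eq_analyticRank_of_analyticRank_le_one)
    (hKim : kim_analyticRank_eq_one_of_mordellWeilRank_eq_one)
    (hBT : burungaleTian_analyticRank_eq_one_of_selmerCorank_eq_one_of_hasCM)
    (hmod : exists_isNewformOf) (hMC : burungale_castella_skinner_charIdeal_eq_padicLFunction)
    (hS : Schneider1985_order_charGenerator)
    (hpar : ∀ (W : WeierstrassCurve ℚ) [W.IsElliptic] (p : ℕ) [Fact p.Prime],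
      selmerCorank_mod_two_eq W p)
    (hP : PAdicBSDRank)
    (W : WeierstrassCurve ℚ) [W.IsElliptic] (hne : W.analyticRank ≠ W.mordellWeilRank) :
    2 ≤ W.analyticRank ∧ 2 ≤ W.mordellWeilRank ∧
      W.analyticRank % 2 = W.mordellWeilRank % 2 ∧ 4 ≤ max W.analyticRank W.mordellWeilRank :=
  forall_of_forall_isGloballyMinimal
    (fun r a => a ≠ r → 2 ≤ a ∧ 2 ≤ r ∧ a % 2 = r % 2 ∧ 4 ≤ max a r)
    (fun V _ _ =>
      two_le_min_of_analyticRank_ne_mordellWeilRank_of_padicBSDRank_of_isGloballyMinimal hGZK hKim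
        hBT hmod hMC hS hpar hP V)
    W hne

/-- **Main theorem. Granting the `p`-adic rank conjecture, the classical rank conjecture is exactly
order agreement from degree four:** `BirchSwinnertonDyer ↔ OrderAgreementFromFour`.
(`→`: `a = r = ρ_p`.  `←`: on a global minimal model pick a suitable `p` and a newform; a failure
`a ≠ r` has `4 ≤ max(a, r) = max(a, ρ_p)`, so the agreement applies and `a = ρ_p = r`.)
[cite: MazurTateTeitelbaum1986Invent, §II.18–19] [cite: Kato2004, Thm 18.4]
[cite: Kim2022, Cor. 1.4] [cite: DokchitserDokchitserAnnals2010, Thm. 1.4] -/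
theorem bsd_iff_orderAgreementFromFour_of_padicBSDRank
    (hGZK : rank_eq_analyticRank_of_analyticRank_le_one)
    (hKim : kim_analyticRank_eq_one_of_mordellWeilRank_eq_one)
    (hBT : burungaleTian_analyticRank_eq_one_of_selmerCorank_eq_one_of_hasCM)
    (hmod : exists_isNewformOf) (hMC : burungale_castella_skinner_charIdeal_eq_padicLFunction)
    (hS : Schneider1985_order_charGenerator)
    (hpar : ∀ (W : WeierstrassCurve ℚ) [W.IsElliptic] (p : ℕ) [Fact p.Prime],
      selmerCorank_mod_two_eq W p)
    (hP : PAdicBSDRank) :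
    _root_.BirchSwinnertonDyer ↔ OrderAgreementFromFour := by
  constructor
  · intro hbsd W hE _ p _ hp hgood hord hirr N _ f hf _
    rw [hP W p hp hgood hord hirr f hf, hbsd W hE]
  · intro hOA
    refine forall_of_forall_isGloballyMinimal (fun r a => a = r) (fun V _ _ => ?_)
    by_contra hne
    obtain ⟨-, -, -, h4⟩ :=
      two_le_min_of_analyticRank_ne_mordellWeilRank_of_padicBSDRank_of_isGloballyMinimal hGZK hKim
        hBT hmod hMC hS hpar hP V hne
    obtain ⟨p, hgt, ⟨hp, hgood, hord⟩, hirr⟩ :=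
      V.exists_gt_mem_goodOrdinaryPrimes_hasIrreducibleModPGaloisRep 4
    haveI : NeZero (V.conductorNorm ℤ) := ⟨(V.conductorNorm_pos_holds).ne'⟩
    obtain ⟨f, hf⟩ := hmod V
    have hρ := hP V p (by omega) hgood hord hirr f hf
    have h4' : 4 ≤ (padicLFunction f (unitRoot V p : ℚ_[p])).order ∨ 4 ≤ V.analyticRank := by
      rcases le_max_iff.mp h4 with h | h
      · exact Or.inr h
      · refine Or.inl ?_
        rw [hρ]
        exact_mod_cast h
    have heq := hOA V p (by omega) hgood hord hirr f hf h4'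
    rw [hρ] at heq
    exact hne (by exact_mod_cast heq.symm)

/-- **The exchange identity.** Over the published facts:
`(classical rank BSD ∧ ShaFiniteSchneider) ↔ (p-adic rank BSD ∧ OrderAgreementFromFour)` —
finiteness of `Ш[p^∞]` with Schneider's non-degeneracy on the classical side is worth exactly the
`p`-adic rank conjecture, and what the latter leaves of the former is order agreement from degree
four. [cite: MazurTateTeitelbaum1986Invent, §II.18–19] [cite: BalakrishnanMullerStein2015, Thm. 1.7]
[cite: BurungaleCastellaSkinner2025, Thm. 1.1.2 (a)] -/
theorem bsd_and_shaFiniteSchneider_iff_padicBSDRank_and_orderAgreementFromFour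
    (hGZK : rank_eq_analyticRank_of_analyticRank_le_one)
    (hKim : kim_analyticRank_eq_one_of_mordellWeilRank_eq_one)
    (hBT : burungaleTian_analyticRank_eq_one_of_selmerCorank_eq_one_of_hasCM)
    (hmod : exists_isNewformOf) (hMC : burungale_castella_skinner_charIdeal_eq_padicLFunction)
    (hS : Schneider1985_order_charGenerator)
    (hpar : ∀ (W : WeierstrassCurve ℚ) [W.IsElliptic] (p : ℕ) [Fact p.Prime],
      selmerCorank_mod_two_eq W p) :
    (_root_.BirchSwinnertonDyer ∧ ShaFiniteSchneider) ↔ (PAdicBSDRank ∧ OrderAgreementFromFour) := by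
  constructor
  · rintro ⟨hbsd, hSS⟩
    have hP : PAdicBSDRank := (padicBSDRank_iff_shaFiniteSchneider hmod hMC hS).2 hSS
    exact ⟨hP, (bsd_iff_orderAgreementFromFour_of_padicBSDRank hGZK hKim hBT hmod hMC hS hpar hP).1
      hbsd⟩
  · rintro ⟨hP, hOA⟩
    exact ⟨(bsd_iff_orderAgreementFromFour_of_padicBSDRank hGZK hKim hBT hmod hMC hS hpar hP).2 hOA,
      (padicBSDRank_iff_shaFiniteSchneider hmod hMC hS).1 hP⟩

/-- **The residual in `(ord, rank)`-terms.** Granting `PAdicBSDRank` and the published facts,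
`BirchSwinnertonDyer ↔ (∀ E, rank ≥ 4 → rank ≤ ord) ∧ (∀ E, ord ≥ 4 → ord ≤ rank)`: the two
one-sided layers from degree four, "four independent points force `L⁗(E,1)`-order vanishing" and
"fourth-order vanishing forces four independent points", are all that remains — and neither has a
known instance. [cite: Kim2022, Cor. 1.4] [cite: DokchitserDokchitserAnnals2010, Thm. 1.4]
[cite: Darmon2004, Thm. 3.22] -/
theorem bsd_iff_fourLayers_of_padicBSDRank
    (hGZK : rank_eq_analyticRank_of_analyticRank_le_one)
    (hKim : kim_analyticRank_eq_one_of_mordellWeilRank_eq_one)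
    (hBT : burungaleTian_analyticRank_eq_one_of_selmerCorank_eq_one_of_hasCM)
    (hmod : exists_isNewformOf) (hMC : burungale_castella_skinner_charIdeal_eq_padicLFunction)
    (hS : Schneider1985_order_charGenerator)
    (hpar : ∀ (W : WeierstrassCurve ℚ) [W.IsElliptic] (p : ℕ) [Fact p.Prime],
      selmerCorank_mod_two_eq W p)
    (hP : PAdicBSDRank) :
    _root_.BirchSwinnertonDyer ↔
      (∀ W : WeierstrassCurve ℚ, W.IsElliptic → 4 ≤ W.mordellWeilRank →
          W.mordellWeilRank ≤ W.analyticRank) ∧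
        (∀ W : WeierstrassCurve ℚ, W.IsElliptic → 4 ≤ W.analyticRank →
          W.analyticRank ≤ W.mordellWeilRank) := by
  constructor
  · intro hbsd
    exact ⟨fun W hE _ => (hbsd W hE).ge, fun W hE _ => (hbsd W hE).le⟩
  · rintro ⟨hup, hlow⟩ W hE
    by_contra hne
    obtain ⟨-, -, -, h4⟩ :=
      two_le_min_of_analyticRank_ne_mordellWeilRank_of_padicBSDRank hGZK hKim hBT hmod hMC hS hpar
        hP W hne
    have h1 := hup W hE
    have h2 := hlow W hE
    rcases le_max_iff.mp h4 with h | h <;> omega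

end Facts

end Summit.BirchSwinnertonDyer.BirchSwinnertonDyer.Theorems.SoloBlind
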